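import Mathlib
import HarnessLib
import Summits.AtomisticToContinuum.FouriersLaw.Theses.JunctionLocality
import Summits.AtomisticToContinuum.FouriersLaw.Theorems.JunctionLocalityConductanceLowerBoundStubFisherSquare
import Summits.AtomisticToContinuum.FouriersLaw.Theorems.JunctionLocalityConductanceLowerBoundFloorEquivalence

/-!
# The odd-field frame of the transmission-gradient floor (crux stmt-AtomisticToContinuum-11749, line ForecastSensitivitySketch)

Helper file (`--supports stmt-AtomisticToContinuum-11749`, lead c3).  Fix `pinnedChain ω₂ lam β γ` (all `> 0`), `T > 0`,
`L ≥ 2`, `μ_T = gibbsMeasure L T`, and a classical mean-zero `C² ∩ L²(μ_T)` forward field `g` of the LEFT bath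
(`L_{T,T} g = −(p_0² − T)`).  Write `R` for the site reflection, `A = ∂_{p_{L−1}} g` (far gradient), `B = (∂_{p_0} g) ∘ R`,
`E_far = ‖A‖²`, `E_near = ‖∂_{p_0} g‖²` (all norms in `L²(μ_T)`).  The landed identities (Kubo link, row sum, far-contact
Fisher square, FloorEquivalence) say `D_L = (L−1)(2γ³/T)·E_far`, so the crux is the floor `(L−1)E_far ≥ c`.  This file records
the exact CONTACT BUDGET of the forward field, i.e. the frame in which the floor is an UPPER bound:

* `farGradient_budget` — `γ(A + B) = p_{L−1}` pointwise (conservation `γ(g + g∘R) = H − ⟨H⟩` differentiated along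
  `p_{L−1}`) and `‖A‖² = ⟨A, B⟩` (Fisher square + Gaussian projection);
* `nearGradient_sq_eq` — the SUM RULE `E_near = T/γ² − 3·E_far`;
* `oddField_farGradient_sq_eq` — for the reflection-odd field `a = (g − g∘R)/2` (the response to the antisymmetric source
  `(k_0 − k_{L−1})/2`, `k_b = p_b² − T`): `‖∂_{p_{L−1}} a‖² = T/(4γ²) − E_far`;
* `farGradient_sq_le` — hence the CONTACT BOUND `E_far ≤ T/(4γ²)` (i.e. `G_L = D_L/(L−1) ≤ γ/2`).

The companion file `…OddFieldCeiling` turns these into `D_L ≤ (L−1)γ/2` along the crux's data and into the equivalence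
FLOOR ⟺ ODD-FIELD CEILING `‖∂_{p_{L−1}} a‖² ≤ T/(4γ²) − c/(L−1)` (crux NOTES T4 (iii), kernel-checked).
No new definitions (the odd field is spelled out), no named facts, no sorry.
-/

noncomputable section

open MeasureTheory Filter Topology
open scoped ContDiff
open Literature.MathematicalPhysics.KineticTheory.HeatConduction
open Summit.AtomisticToContinuum.FouriersLaw.Theorems.SuperadditiveResistance.DeviceLiouville
  (kin kin_eq_sq continuous_kin liouvilleOp bathOp generator_eq_liouvilleOp_add eq_zero_of_liouville_pinnedChain)
open Summit.AtomisticToContinuum.FouriersLaw.Theorems.SuperadditiveResistance.Kubo (memLp_partialP)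
open Summit.AtomisticToContinuum.FouriersLaw.Cruxes.SuperadditiveResistance.FloatingProbeBypassLaplacian
  (pinnedChain_memLp_two_snd_sq integral_mul_sq_sub_gibbsMeasure integral_mul_sq_sub_gibbsMeasure_eq_zero
    generator_sub_const partialP_sub_const'
    liouvilleOp_add' liouvilleOp_const_mul bathOp_add' bathOp_const_mul stub_plainForwardField)
open Summit.AtomisticToContinuum.FouriersLaw.Cruxes.SuperadditiveResistance.InsertionToolbox
  (pinnedChain_memLp_two_of_abs_le)

namespace Summit.AtomisticToContinuum.FouriersLaw.Cruxes.ConductanceLowerBound.ForecastSensitivity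

variable {ω₂ lam β γ T : ℝ}

/-! ## §1 The contact budget of the forward field -/

/-- **Contact budget of the left forward field.**  For `L ≥ 2` and a classical mean-zero `C² ∩ L²(μ_T)` left forward field
`g`: with `A = ∂_{p_{L−1}} g` and `B = (∂_{p_0} g)∘R`, (i) `γ(A + B) = p_{L−1}` pointwise, (ii) `A, B ∈ L²(μ_T)`,
(iii) `‖A‖² = ⟨A, B⟩`, (iv) `‖B‖ = ‖∂_{p_0} g‖`.  (Conservation `γ(g + g∘R) = H − ⟨H⟩` by the `L²(μ_T)`-Liouville theorem,
differentiated along `p_{L−1}`; far-contact Fisher square; Gaussian projection.) [folklore] -/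
theorem farGradient_budget (hω : 0 < ω₂) (hl : 0 < lam) (hβ : 0 < β) (hγ : 0 < γ) (hT : 0 < T)
    {L : ℕ} (hL : 2 ≤ L) {g : PhaseSpace L → ℝ} (hgC : ContDiff ℝ 2 g)
    (hgL2 : MemLp g 2 ((pinnedChain ω₂ lam β γ).gibbsMeasure L T))
    (hg0 : ∫ x, g x ∂((pinnedChain ω₂ lam β γ).gibbsMeasure L T) = 0)
    (hgeq : ∀ x, (pinnedChain ω₂ lam β γ).generator L T T g x = -(kin L 0 x - T)) :
    (∀ x, γ * (partialP (⟨L - 1, by omega⟩ : Fin L) g x +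
        partialP (⟨0, by omega⟩ : Fin L) g (siteReflection L x)) = x.2 ⟨L - 1, by omega⟩) ∧
    MemLp (partialP (⟨L - 1, by omega⟩ : Fin L) g) 2 ((pinnedChain ω₂ lam β γ).gibbsMeasure L T) ∧
    MemLp (fun x => partialP (⟨0, by omega⟩ : Fin L) g (siteReflection L x)) 2
      ((pinnedChain ω₂ lam β γ).gibbsMeasure L T) ∧
    (∫ x, (partialP (⟨L - 1, by omega⟩ : Fin L) g x) ^ 2 ∂((pinnedChain ω₂ lam β γ).gibbsMeasure L T) =
      ∫ x, partialP (⟨L - 1, by omega⟩ : Fin L) g x * partialP (⟨0, by omega⟩ : Fin L) g (siteReflection L x)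
        ∂((pinnedChain ω₂ lam β γ).gibbsMeasure L T)) ∧
    (∫ x, (partialP (⟨0, by omega⟩ : Fin L) g (siteReflection L x)) ^ 2 ∂((pinnedChain ω₂ lam β γ).gibbsMeasure L T) =
      ∫ x, (partialP (⟨0, by omega⟩ : Fin L) g x) ^ 2 ∂((pinnedChain ω₂ lam β γ).gibbsMeasure L T)) := by
  have hL0 : 0 < L := by omega
  have hL1 : L - 1 < L := by omega
  set P := pinnedChain ω₂ lam β γ with hP
  set μ := P.gibbsMeasure L T with hμ
  set H := P.hamiltonian L with hH
  set Bw := OscillatorChain.bathWeight L with hBw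
  set i0 : Fin L := ⟨0, hL0⟩ with hi0
  set iR : Fin L := ⟨L - 1, hL1⟩ with hiR
  haveI : IsProbabilityMeasure μ := pinnedChain_isProbabilityMeasure_gibbsMeasure hω hl.le hβ.le γ L hT
  have hPγ : P.γ = γ := rfl
  have hV : ∀ r, P.V (-r) = P.V r := pinnedChain_V_neg ω₂ lam β γ
  have hR : MeasurePreserving (siteReflectionEquiv L) μ μ := measurePreserving_siteReflection_gibbsMeasure P hV L T
  have hrevR : Fin.rev iR = i0 := Fin.ext (by simp only [Fin.val_rev, hiR, hi0]; omega)
  have hrev0 : Fin.rev i0 = iR := Fin.ext (by simp only [Fin.val_rev, hiR, hi0])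
  have hBnn : ∀ i, 0 ≤ Bw i := bathWeight_nonneg L
  have hBi0 : 0 < Bw i0 := by
    simp only [hBw, OscillatorChain.bathWeight, hi0, if_true]
    split_ifs <;> norm_num
  have hBiR : 0 < Bw iR := by
    simp only [hBw, OscillatorChain.bathWeight, hiR, if_true]
    split_ifs <;> norm_num
  -- regularity
  have hgd : Differentiable ℝ g := hgC.differentiable two_ne_zero
  have hHs : ContDiff ℝ ∞ H :=
    P.contDiff_hamiltonian (pinnedChain_contDiff_U ω₂ lam β γ) (pinnedChain_contDiff_V ω₂ lam β γ) L
  have hH2 : ContDiff ℝ 2 H := hHs.of_le (by norm_cast)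
  have hH0 : ∀ x, 0 ≤ H x := fun x => pinnedChain_hamiltonian_nonneg hω.le hl.le hβ.le γ L x
  have hHL2 : MemLp H 2 μ :=
    pinnedChain_memLp_two_of_abs_le hω hl.le hβ.le γ L hT hHs.continuous (C := 1) (k := 1) fun x => by
      rw [abs_of_nonneg (hH0 x), pow_one, one_mul]
      linarith [hH0 x]
  have hk0L2 : MemLp (fun x => kin L 0 x - T) 2 μ :=
    ((pinnedChain_memLp_two_snd_sq hω hl.le hβ.le γ L hT ⟨0, hL0⟩).sub (memLp_const T)).ae_eq
      (ae_of_all _ fun x => by simp [kin_eq_sq hL0])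
  have hpg : ∀ x, 1 * liouvilleOp P L g x + γ * bathOp L Bw T g x = -(kin L 0 x - T) := fun x => by
    rw [one_mul, ← hgeq x, generator_eq_liouvilleOp_add]; rfl
  have haL2 : MemLp (partialP iR g) 2 μ := memLp_partialP hω hl.le hβ.le γ L hT Bw hBnn 1 hγ hgC hgL2 hk0L2 hpg hBiR
  have ha0L2 : MemLp (partialP i0 g) 2 μ := memLp_partialP hω hl.le hβ.le γ L hT Bw hBnn 1 hγ hgC hgL2 hk0L2 hpg hBi0
  -- the reflected field is the right bath's forward field
  set gR : PhaseSpace L → ℝ := g ∘ siteReflection L with hgR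
  have hgRC : ContDiff ℝ 2 gR := hgC.comp contDiff_siteReflection
  have hgRd : Differentiable ℝ gR := hgRC.differentiable two_ne_zero
  have hgRL2 : MemLp gR 2 μ := hgL2.comp_measurePreserving hR
  have hgR0 : ∫ x, gR x ∂μ = 0 := by
    have h := hR.integral_comp' (f := siteReflectionEquiv L) g
    simp only [siteReflectionEquiv_apply] at h
    rw [hg0] at h
    simpa only [hgR, Function.comp_apply] using h
  have hgReq : ∀ x, P.generator L T T gR x = -(kin L (L - 1) x - T) := by
    intro x
    rw [hgR, P.generator_comp_siteReflection hV L T T g x, hgeq, kin_zero_siteReflection hL0]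
  -- energy conservation: `u = γ (g + g∘R) − (H − ⟨H⟩)` vanishes
  set cH : ℝ := ∫ x, H x ∂μ with hcH
  have hC1 : ContDiff ℝ 2 (fun y => γ * (g + gR) y) := contDiff_const.mul (hgC.add hgRC)
  have hC2 : ContDiff ℝ 2 (fun y => (-1 : ℝ) * (H y - cH)) := contDiff_const.mul (hH2.sub contDiff_const)
  set u : PhaseSpace L → ℝ := (fun y => γ * (g + gR) y) + fun y => (-1 : ℝ) * (H y - cH) with hu
  have huC : ContDiff ℝ 2 u := hC1.add hC2
  have huL2 : MemLp u 2 μ := ((hgL2.add hgRL2).const_mul γ).add ((hHL2.sub (memLp_const cH)).const_mul (-1))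
  have gen_add : ∀ {f₁ f₂ : PhaseSpace L → ℝ}, ContDiff ℝ 2 f₁ → ContDiff ℝ 2 f₂ → ∀ x,
      P.generator L T T (f₁ + f₂) x = P.generator L T T f₁ x + P.generator L T T f₂ x := by
    intro f₁ f₂ h₁ h₂ x
    rw [generator_eq_liouvilleOp_add, generator_eq_liouvilleOp_add, generator_eq_liouvilleOp_add,
      liouvilleOp_add' P (h₁.differentiable two_ne_zero) (h₂.differentiable two_ne_zero), bathOp_add' h₁ h₂]
    ring
  have gen_const_mul : ∀ (a : ℝ) (f₁ : PhaseSpace L → ℝ) (x : PhaseSpace L),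
      P.generator L T T (fun y => a * f₁ y) x = a * P.generator L T T f₁ x := by
    intro a f₁ x
    rw [generator_eq_liouvilleOp_add, generator_eq_liouvilleOp_add, liouvilleOp_const_mul, bathOp_const_mul]
    ring
  have hu_gen : ∀ x, P.generator L T T u x = 0 := by
    intro x
    have e1 : P.generator L T T u x = P.generator L T T (fun y => γ * (g + gR) y) x +
        P.generator L T T (fun y => (-1 : ℝ) * (H y - cH)) x := gen_add hC1 hC2 x
    have e2 : P.generator L T T (fun y => γ * (g + gR) y) x = γ * P.generator L T T (g + gR) x :=
      gen_const_mul γ (g + gR) x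
    have e3 : P.generator L T T (g + gR) x = P.generator L T T g x + P.generator L T T gR x := gen_add hgC hgRC x
    have e4 : P.generator L T T (fun y => (-1 : ℝ) * (H y - cH)) x =
        (-1 : ℝ) * P.generator L T T (fun y => H y - cH) x := gen_const_mul (-1) _ x
    have e5 : P.generator L T T (fun y => H y - cH) x = P.generator L T T H x := generator_sub_const P T T H cH x
    have e6 : P.generator L T T H x = -(γ * ((kin L 0 x - T) + (kin L (L - 1) x - T))) := by
      rw [generator_eq_liouvilleOp_add, liouvilleOp_hamiltonian, bathOp_bathWeight_hamiltonian P hL0, hPγ]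
      ring
    rw [e1, e2, e3, e4, e5, e6, hgeq x, hgReq x]
    ring
  have hu_pde : ∀ x, 1 * liouvilleOp P L u x + γ * bathOp L Bw T u x = 0 := fun x => by
    rw [one_mul, ← hu_gen x, generator_eq_liouvilleOp_add]; rfl
  have hgi : Integrable g μ := hgL2.integrable one_le_two
  have hgRi : Integrable gR μ := hgRL2.integrable one_le_two
  have hHi : Integrable H μ := hHL2.integrable one_le_two
  have hu_mean : ∫ x, u x ∂μ = 0 := by
    have i1 : Integrable (fun y => γ * (g y + gR y)) μ := (hgi.add hgRi).const_mul γ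
    have i2 : Integrable (fun y => (-1 : ℝ) * (H y - cH)) μ := (hHi.sub (integrable_const cH)).const_mul (-1)
    simp only [hu, Pi.add_apply]
    rw [integral_add i1 i2, integral_const_mul, integral_const_mul, integral_add hgi hgRi,
      integral_sub hHi (integrable_const cH), integral_const, hg0, hgR0]
    simp [hcH]
  have hu0 : ∀ x, u x = 0 := fun x =>
    eq_zero_of_liouville_pinnedChain hω hl.le hβ.le γ hL0 hT Bw hBnn hBi0 one_ne_zero hγ huC huL2 hu_pde hu_mean x
  have hfun : (fun y => γ * (g y + gR y)) = fun y => H y - cH := by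
    funext y
    have := hu0 y
    simp only [hu, Pi.add_apply] at this
    linarith
  -- (i) the pointwise budget
  have hgrad : ∀ x, γ * (partialP iR g x + partialP i0 g (siteReflection L x)) = x.2 iR := by
    intro x
    have e1 : partialP iR (fun y => γ * (g y + gR y)) x = γ * partialP iR (fun y => g y + gR y) x :=
      partialP_const_mul γ _ iR x
    have e2 : partialP iR (fun y => g y + gR y) x = partialP iR g x + partialP iR gR x :=
      partialP_add hgd hgRd iR x
    have e3 : partialP iR gR x = partialP i0 g (siteReflection L x) := by
      rw [hgR, partialP_comp_siteReflection, hrevR]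
    have e4 : partialP iR (fun y => H y - cH) x = x.2 iR := by rw [partialP_sub_const', P.partialP_hamiltonian]
    have key : partialP iR (fun y => γ * (g y + gR y)) x = partialP iR (fun y => H y - cH) x := by rw [hfun]
    rw [e1, e2, e3, e4] at key
    exact key
  -- (ii) square integrability of `B`
  have hbL2 : MemLp (fun x => partialP i0 g (siteReflection L x)) 2 μ := ha0L2.comp_measurePreserving hR
  -- (iii) `‖A‖² = ⟨A, B⟩`: Fisher square `⟨g, k_{L-1}⟩ = 2γT‖A‖²`, projection `⟨g, k_{L-1}⟩ = T⟨A, p_{L-1}⟩`, budget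
  have hfis : ∫ x, g x * (kin L (L - 1) x - T) ∂μ = 2 * γ * T * ∫ x, (partialP iR g x) ^ 2 ∂μ :=
    stub_fisherSquare ω₂ lam β γ T hω hl hβ hγ hT L hL g hgC hgL2 hg0 hgeq
  have hBf : ∫ x, g x * (kin L (L - 1) x - T) ∂μ = T * ∫ x, partialP iR g x * x.2 iR ∂μ := by
    rw [← integral_mul_sq_sub_gibbsMeasure hω hl.le hβ.le γ L hT iR hgd hgL2 haL2]
    exact integral_congr_ae (ae_of_all _ fun x => by dsimp only; rw [kin_eq_sq hL1])
  have iaa : Integrable (fun x => partialP iR g x ^ 2) μ := haL2.integrable_sq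
  have iab : Integrable (fun x => partialP iR g x * partialP i0 g (siteReflection L x)) μ := haL2.integrable_mul hbL2
  have hI1 : ∫ x, partialP iR g x * x.2 iR ∂μ =
      γ * (∫ x, partialP iR g x ^ 2 ∂μ) + γ * ∫ x, partialP iR g x * partialP i0 g (siteReflection L x) ∂μ := by
    rw [← integral_const_mul, ← integral_const_mul, ← integral_add (iaa.const_mul γ) (iab.const_mul γ)]
    refine integral_congr_ae (ae_of_all _ fun x => ?_)
    dsimp only
    rw [← hgrad x]
    ring
  have hcross : ∫ x, (partialP iR g x) ^ 2 ∂μ = ∫ x, partialP iR g x * partialP i0 g (siteReflection L x) ∂μ := by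
    have hT0 : T ≠ 0 := hT.ne'
    have hγ0 : γ ≠ 0 := hγ.ne'
    have h1 : 2 * γ * T * ∫ x, (partialP iR g x) ^ 2 ∂μ = T * (γ * (∫ x, partialP iR g x ^ 2 ∂μ) +
        γ * ∫ x, partialP iR g x * partialP i0 g (siteReflection L x) ∂μ) := by rw [← hfis, hBf, hI1]
    have h2 : γ * T * (∫ x, (partialP iR g x) ^ 2 ∂μ - ∫ x, partialP iR g x * partialP i0 g (siteReflection L x) ∂μ)
        = 0 := by linarith
    have h3 : γ * T ≠ 0 := mul_ne_zero hγ0 hT0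
    have h4 := (mul_eq_zero.mp h2).resolve_left h3
    linarith
  -- (iv) change of variables
  have hbb : ∫ x, partialP i0 g (siteReflection L x) ^ 2 ∂μ = ∫ x, partialP i0 g x ^ 2 ∂μ := by
    simpa only [siteReflectionEquiv_apply] using
      hR.integral_comp' (f := siteReflectionEquiv L) (fun y => partialP i0 g y ^ 2)
  exact ⟨hgrad, haL2, hbL2, hcross, hbb⟩

/-! ## §2 The sum rule and the contact bound -/

/-- **SUM RULE `E_near = T/γ² − 3·E_far`.**  For `L ≥ 2` and every classical mean-zero `C² ∩ L²(μ_T)` left forward field `g`: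
`∫ (∂_{p_0} g)² dμ_T = T/γ² − 3 ∫ (∂_{p_{L−1}} g)² dμ_T`.  (From `γ(A+B) = p_{L−1}`, `‖A‖² = ⟨A,B⟩`, `‖B‖ = ‖∂_{p_0}g‖`,
`‖p_{L−1}‖² = T`.) [folklore] -/
theorem nearGradient_sq_eq (hω : 0 < ω₂) (hl : 0 < lam) (hβ : 0 < β) (hγ : 0 < γ) (hT : 0 < T)
    {L : ℕ} (hL : 2 ≤ L) {g : PhaseSpace L → ℝ} (hgC : ContDiff ℝ 2 g)
    (hgL2 : MemLp g 2 ((pinnedChain ω₂ lam β γ).gibbsMeasure L T))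
    (hg0 : ∫ x, g x ∂((pinnedChain ω₂ lam β γ).gibbsMeasure L T) = 0)
    (hgeq : ∀ x, (pinnedChain ω₂ lam β γ).generator L T T g x = -(kin L 0 x - T)) :
    ∫ x, (partialP (⟨0, by omega⟩ : Fin L) g x) ^ 2 ∂((pinnedChain ω₂ lam β γ).gibbsMeasure L T) =
      T / γ ^ 2 - 3 * ∫ x, (partialP (⟨L - 1, by omega⟩ : Fin L) g x) ^ 2 ∂((pinnedChain ω₂ lam β γ).gibbsMeasure L T) := by
  have hL0 : 0 < L := by omega
  have hL1 : L - 1 < L := by omega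
  set P := pinnedChain ω₂ lam β γ with hP
  set μ := P.gibbsMeasure L T with hμ
  set i0 : Fin L := ⟨0, hL0⟩ with hi0
  set iR : Fin L := ⟨L - 1, hL1⟩ with hiR
  haveI : IsProbabilityMeasure μ := pinnedChain_isProbabilityMeasure_gibbsMeasure hω hl.le hβ.le γ L hT
  obtain ⟨hgrad, haL2, hbL2, hcross, hbb⟩ := farGradient_budget hω hl hβ hγ hT hL hgC hgL2 hg0 hgeq
  -- `‖γ(A+B)‖² = ‖p_{L-1}‖² = T`
  have hp2 : ∫ x, (x.2 iR) ^ 2 ∂μ = T := by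
    have h0 : ∫ x, (fun _ : PhaseSpace L => (1 : ℝ)) x * (x.2 iR ^ 2 - T) ∂μ = 0 :=
      integral_mul_sq_sub_gibbsMeasure_eq_zero hω hl.le hβ.le γ L hT iR (F := fun _ => (1 : ℝ))
        (fun _ _ => rfl) (memLp_const 1)
    have hint : Integrable (fun x : PhaseSpace L => x.2 iR ^ 2) μ :=
      (pinnedChain_memLp_two_snd_sq hω hl.le hβ.le γ L hT iR).integrable one_le_two
    have h1 : ∫ x, (x.2 iR ^ 2 - T) ∂μ = 0 := by
      rw [← h0]
      exact integral_congr_ae (ae_of_all _ fun x => by simp only [one_mul])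
    rw [integral_sub hint (integrable_const T), integral_const, smul_eq_mul] at h1
    have hμ1 : μ.real Set.univ = 1 := by simp [Measure.real]
    rw [hμ1, one_mul] at h1
    linarith
  have iaa : Integrable (fun x => partialP iR g x ^ 2) μ := haL2.integrable_sq
  have iab : Integrable (fun x => partialP iR g x * partialP i0 g (siteReflection L x)) μ := haL2.integrable_mul hbL2
  have ibb : Integrable (fun x => partialP i0 g (siteReflection L x) ^ 2) μ := hbL2.integrable_sq
  have hexp : ∫ x, (x.2 iR) ^ 2 ∂μ = γ ^ 2 * ((∫ x, partialP iR g x ^ 2 ∂μ) +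
      2 * (∫ x, partialP iR g x * partialP i0 g (siteReflection L x) ∂μ) +
      ∫ x, partialP i0 g (siteReflection L x) ^ 2 ∂μ) := by
    have e1 : ∫ x, (x.2 iR) ^ 2 ∂μ = ∫ x, γ ^ 2 * ((partialP iR g x ^ 2 +
        2 * (partialP iR g x * partialP i0 g (siteReflection L x))) + partialP i0 g (siteReflection L x) ^ 2) ∂μ := by
      refine integral_congr_ae (ae_of_all _ fun x => ?_)
      dsimp only
      rw [← hgrad x]
      ring
    have i12 : Integrable (fun a => partialP iR g a ^ 2 +
        2 * (partialP iR g a * partialP i0 g (siteReflection L a))) μ := iaa.add (iab.const_mul 2)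
    have i2 : Integrable (fun a => 2 * (partialP iR g a * partialP i0 g (siteReflection L a))) μ := iab.const_mul 2
    rw [e1, integral_const_mul, integral_add i12 ibb, integral_add iaa i2, integral_const_mul]
  rw [← hbb]
  rw [hp2, ← hcross] at hexp
  have hγ2 : γ ^ 2 ≠ 0 := pow_ne_zero 2 hγ.ne'
  have key : ∫ x, partialP i0 g (siteReflection L x) ^ 2 ∂μ = T / γ ^ 2 - 3 * ∫ x, partialP iR g x ^ 2 ∂μ := by
    rw [eq_sub_iff_add_eq, eq_div_iff hγ2]
    linear_combination -hexp
  exact key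

/-- **ODD-FIELD CONTACT IDENTITY.**  For `L ≥ 2`, every classical mean-zero `C² ∩ L²(μ_T)` left forward field `g`, and the
reflection-odd field `a(x) = (g(x) − g(Rx))/2` (the classical solution of `L_{T,T} a = −(k_0 − k_{L−1})/2`):
`∫ (∂_{p_{L−1}} a)² dμ_T = T/(4γ²) − ∫ (∂_{p_{L−1}} g)² dμ_T`.  Equivalently `G_L = γ/2 − (2γ³/T)‖∂_{p_{L−1}} a‖²`: the
conductance is the insulator-free value `γ/2` minus the contact Dirichlet energy of the antisymmetric response. [folklore] -/
theorem oddField_farGradient_sq_eq' (hω : 0 < ω₂) (hl : 0 < lam) (hβ : 0 < β) (hγ : 0 < γ) (hT : 0 < T)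
    {L : ℕ} (hL : 2 ≤ L) {g : PhaseSpace L → ℝ} (hgC : ContDiff ℝ 2 g)
    (hgL2 : MemLp g 2 ((pinnedChain ω₂ lam β γ).gibbsMeasure L T))
    (hg0 : ∫ x, g x ∂((pinnedChain ω₂ lam β γ).gibbsMeasure L T) = 0)
    (hgeq : ∀ x, (pinnedChain ω₂ lam β γ).generator L T T g x = -(kin L 0 x - T)) :
    ∫ x, (partialP (⟨L - 1, by omega⟩ : Fin L) (fun y => (g y - g (siteReflection L y)) / 2) x) ^ 2
        ∂((pinnedChain ω₂ lam β γ).gibbsMeasure L T) =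
      T / (4 * γ ^ 2) - ∫ x, (partialP (⟨L - 1, by omega⟩ : Fin L) g x) ^ 2 ∂((pinnedChain ω₂ lam β γ).gibbsMeasure L T) := by
  have hL0 : 0 < L := by omega
  have hL1 : L - 1 < L := by omega
  set P := pinnedChain ω₂ lam β γ with hP
  set μ := P.gibbsMeasure L T with hμ
  set i0 : Fin L := ⟨0, hL0⟩ with hi0
  set iR : Fin L := ⟨L - 1, hL1⟩ with hiR
  haveI : IsProbabilityMeasure μ := pinnedChain_isProbabilityMeasure_gibbsMeasure hω hl.le hβ.le γ L hT
  obtain ⟨hgrad, haL2, hbL2, hcross, hbb⟩ := farGradient_budget hω hl hβ hγ hT hL hgC hgL2 hg0 hgeq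
  have hnear := nearGradient_sq_eq hω hl hβ hγ hT hL hgC hgL2 hg0 hgeq
  have hrevR : Fin.rev iR = i0 := Fin.ext (by simp only [Fin.val_rev, hiR, hi0]; omega)
  have hgd : Differentiable ℝ g := hgC.differentiable two_ne_zero
  have hgRd : Differentiable ℝ (g ∘ siteReflection L) := (hgC.comp contDiff_siteReflection).differentiable two_ne_zero
  -- `∂_{p_{L-1}} a = (A − B)/2` pointwise
  have hda : ∀ x, partialP iR (fun y => (g y - g (siteReflection L y)) / 2) x =
      (partialP iR g x - partialP i0 g (siteReflection L x)) / 2 := by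
    intro x
    have e0 : (fun y => (g y - g (siteReflection L y)) / 2) = fun y => (1 / 2 : ℝ) * (g y - (g ∘ siteReflection L) y) := by
      funext y; simp only [Function.comp_apply]; ring
    rw [e0, partialP_const_mul,
      Summit.AtomisticToContinuum.FouriersLaw.Theorems.SuperadditiveResistance.DeviceLiouville.partialP_sub hgd hgRd,
      partialP_comp_siteReflection, hrevR]
    ring
  have iaa : Integrable (fun x => partialP iR g x ^ 2) μ := haL2.integrable_sq
  have iab : Integrable (fun x => partialP iR g x * partialP i0 g (siteReflection L x)) μ := haL2.integrable_mul hbL2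
  have ibb : Integrable (fun x => partialP i0 g (siteReflection L x) ^ 2) μ := hbL2.integrable_sq
  have hexp : ∫ x, (partialP iR (fun y => (g y - g (siteReflection L y)) / 2) x) ^ 2 ∂μ =
      (1 / 4 : ℝ) * ((∫ x, partialP iR g x ^ 2 ∂μ) - 2 * (∫ x, partialP iR g x * partialP i0 g (siteReflection L x) ∂μ) +
        ∫ x, partialP i0 g (siteReflection L x) ^ 2 ∂μ) := by
    have e1 : ∫ x, (partialP iR (fun y => (g y - g (siteReflection L y)) / 2) x) ^ 2 ∂μ =
        ∫ x, (1 / 4 : ℝ) * ((partialP iR g x ^ 2 - 2 * (partialP iR g x * partialP i0 g (siteReflection L x))) +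
          partialP i0 g (siteReflection L x) ^ 2) ∂μ := by
      refine integral_congr_ae (ae_of_all _ fun x => ?_)
      dsimp only
      rw [hda x]
      ring
    have i12 : Integrable (fun a => partialP iR g a ^ 2 -
        2 * (partialP iR g a * partialP i0 g (siteReflection L a))) μ := iaa.sub (iab.const_mul 2)
    have i2 : Integrable (fun a => 2 * (partialP iR g a * partialP i0 g (siteReflection L a))) μ := iab.const_mul 2
    rw [e1, integral_const_mul, integral_add i12 ibb, integral_sub iaa i2, integral_const_mul]
  rw [hexp, hbb, hnear, ← hcross]
  ring

/-- **ODD-FIELD CONTACT IDENTITY (registered helper `oddField_farGradient_sq_eq`, verbatim signature).**  For every left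
forward field `g` of the `L`-chain (`L ≥ 2`) and its reflection-odd part `a = (g − g∘R)/2`:
`‖∂_{p_{L−1}} a‖² = T/(4γ²) − ‖∂_{p_{L−1}} g‖²` in `L²(μ_T)`. [folklore] -/
theorem oddField_farGradient_sq_eq : ∀ {ω₂ lam β γ T : ℝ}, 0 < ω₂ → 0 < lam → 0 < β → 0 < γ → 0 < T → ∀ {L : ℕ} (hL : 2 ≤ L) {g : PhaseSpace L → ℝ}, ContDiff ℝ 2 g → MemLp g 2 ((pinnedChain ω₂ lam β γ).gibbsMeasure L T) → ∫ x, g x ∂((pinnedChain ω₂ lam β γ).gibbsMeasure L T) = 0 → (∀ x, (pinnedChain ω₂ lam β γ).generator L T T g x = -(kin L 0 x - T)) → ∫ x, (partialP (⟨L - 1, by omega⟩ : Fin L) (fun y => (g y - g (siteReflection L y)) / 2) x) ^ 2 ∂((pinnedChain ω₂ lam β γ).gibbsMeasure L T) = T / (4 * γ ^ 2) - ∫ x, (partialP (⟨L - 1, by omega⟩ : Fin L) g x) ^ 2 ∂((pinnedChain ω₂ lam β γ).gibbsMeasure L T) :=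
  fun hω hl hβ hγ hT _ hL _ hgC hgL2 hg0 hgeq => oddField_farGradient_sq_eq' hω hl hβ hγ hT hL hgC hgL2 hg0 hgeq

/-- **CONTACT BOUND `E_far ≤ T/(4γ²)`** (i.e. `G_L ≤ γ/2`: at most half of a contact fluctuation crosses the chain), for every
`L ≥ 2` and every classical mean-zero `C² ∩ L²(μ_T)` left forward field. [folklore] -/
theorem farGradient_sq_le (hω : 0 < ω₂) (hl : 0 < lam) (hβ : 0 < β) (hγ : 0 < γ) (hT : 0 < T)
    {L : ℕ} (hL : 2 ≤ L) {g : PhaseSpace L → ℝ} (hgC : ContDiff ℝ 2 g)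
    (hgL2 : MemLp g 2 ((pinnedChain ω₂ lam β γ).gibbsMeasure L T))
    (hg0 : ∫ x, g x ∂((pinnedChain ω₂ lam β γ).gibbsMeasure L T) = 0)
    (hgeq : ∀ x, (pinnedChain ω₂ lam β γ).generator L T T g x = -(kin L 0 x - T)) :
    ∫ x, (partialP (⟨L - 1, by omega⟩ : Fin L) g x) ^ 2 ∂((pinnedChain ω₂ lam β γ).gibbsMeasure L T) ≤ T / (4 * γ ^ 2) := by
  have h := oddField_farGradient_sq_eq' hω hl hβ hγ hT hL hgC hgL2 hg0 hgeq
  have hnn : 0 ≤ ∫ x, (partialP (⟨L - 1, by omega⟩ : Fin L) (fun y => (g y - g (siteReflection L y)) / 2) x) ^ 2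
      ∂((pinnedChain ω₂ lam β γ).gibbsMeasure L T) := integral_nonneg fun x => sq_nonneg _
  linarith

end Summit.AtomisticToContinuum.FouriersLaw.Cruxes.ConductanceLowerBound.ForecastSensitivity

end
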